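import Literature.Geometry.Lorentzian.KerrConvergence
import Literature.Geometry.Lorentzian.CauchyDevelopment
import HarnessLib

/-!
# Tame far frames of a Cauchy development (summit `FinalStateConjecture`)

The **tame far frame** vocabulary wanted by the line `far-tail-peeling-one-leaf` of the crux
`Capture` (item stmt-FinalStateConjecture-10115, routes `BartnikGapSettling` / `QuietWindowCapture`)
of the summit `FinalStateConjecture` (work item `defn-IsTameFarFrame`): §1 of the registered
skeleton `Summits/FinalStateConjecture/FinalStateConjecture/Cruxes/Capture/Lines/
far_tail_peeling_one_leaf.lean` (namespace `…Cruxes.Capture.FarTailPeelingOneLeaf`), landed here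
VERBATIM — same names, same binders, same bodies — so that the `--supports` files of the four
registered stubs `stub_farFrame` / `stub_farTail` / `stub_cores` / `stub_engine` can state them
over Literature without importing the Lines file (after `open Literature.Geometry.Lorentzian` the
stub texts elaborate to the same terms). Companion of `NearKerrLeaf.lean` (same status, below).

## Contents (all over the existing notions `E3`/`E4`, `E4.spatial`, `E4.ofTimeSpace`,
## `Spacetime.deviationExtend`, `Minkowski.backgroundOn`, `supCkENorm`, `CauchyDevelopment`)

Far-frame geometry in the global chart `E4` (index `0` = time, `E4.spatial` = space):
* `centreDist c x = |x̲ − c(x⁰)|` — coordinate distance to the centre curve `c : ℝ → E3`;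
* `nearestDist c x = min_i centreDist (c i) x` for `n` centres `c : Fin n → ℝ → E3`;
* `farZone c Rt T₀ = {x⁰ > T₀, |x̲ − cᵢ(x⁰)| > Rt ∀ i}` — late times, outside all tubes;
* `farShell c Rt T s` — the dyadic shell `{x⁰ = T, outside the tubes, s ≤ nearestDist ≤ 2s}`;
* `cellShell c i Rt T s` — the dyadic shell of the Voronoi cell of centre `i`;
* `outgoingNull c x = ∂₀ + (x̲ − c(x⁰))/|x̲ − c(x⁰)|` — the outgoing null vector of centre `c`;
* `separation c i t = min_{j ≠ i} |cᵢ(t) − cⱼ(t)|` (`= 0` for a single centre, documented junk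
  value: Lean's `x / 0 = 0` then kills the companion term `C s / Dᵢ`).

Tame far frames of a Cauchy development `𝒟` (one chart `Φ : U → 𝒟`, `U : Opens E4`):
* `farDeviation 𝒟 U Φ = Φ^* g − η` extended by `0` off `U` (`Spacetime.deviationExtend` against
  `Minkowski.backgroundOn U`);
* `incomingDeriv 𝒟 c U Φ x = D(wᶜ · (Φ^* g − η))(x)[L(x)]`, the outgoing null derivative of the
  radius-weighted deviation ("no incoming radiation" quantity; lowest-order peeling, pointwise);
* `IsTameFarFrame 𝒟 k n c Rt C T₀ lam U Φ` — `n ≥ 1` continuous, mutually receding centre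
  curves, tube radius `Rt > 0`, slack `λ → 0`, `U ⊇` far zone, `Φ` smooth and an open embedding
  on the far zone with image in `J⁺(ι X)`, and on every late slab `{x⁰ = T}`, `T > T₀`, the `Cᵏ`
  sup of `Φ^* g − η` over the dyadic shell at nearest-centre distance `∼ s` is `≤ C/s + λ(T)`;
* `IsTameFarFrameWithTail 𝒟 k n c Rt C T₀ lam om U Φ` — moreover a modulus `ω → 0` with the
  INCOMING-TAIL bound `sup_{cellShell} ‖incomingDeriv‖_{Cᵏ} ≤ (ω(s) + λ(T))/s + C s / Dᵢ(T)`;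
* the proved lemmas asked for by the item: `IsTameFarFrameWithTail.isTameFarFrame`,
  `IsTameFarFrame.of_le`, `IsTameFarFrameWithTail.of_le` (monotonicity in the order `k`, from
  `supCkENorm_mono_right`), plus named projections of the clauses and sanity API for the shells
  (`cellShell ⊆ farShell`, `⋃ᵢ cellShell = farShell`, `farShell ⊆ farZone`, the separation of a
  tame far frame with `n ≥ 2` tends to `∞`).

## Sources and status

Consequence-form chart/deviation vocabulary ("a chart in which the `Cᵏ` deviation from the
reference form is small"): Dafermos–Holzegel–Rodnianski–Taylor arXiv:2104.08222, §1, as in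
`KerrConvergence`. The far wave zone, the outgoing null frame `L = ∂_t + ∂_r` and the lowest-order
pointwise peeling of the radiation field along outgoing cones for all retarded times:
Christodoulou–Klainerman 1993, Ch. 17 (Conclusion 17.0.1: on every `C_u` the normalised
components `r α̲, r² β̲, r³ ρ, r³ σ` have limits as `t → ∞`); Klainerman–Nicolò, CQG 20 (2003)
(peeling in the external region of asymptotically flat data). The predicates `IsTameFarFrame` /
`IsTameFarFrameWithTail` themselves have NO printed source: they are posited by the line
(planner `planner-cruxplan-stmt-FinalStateConjecture-10115-far-tail-peeling-one-0`, 2026-08-16)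
and recorded here so that its stubs can be restated readably; nothing is asserted about them
(their existence for an MGHD is exactly the content of the stubs `stub_farFrame`/`stub_farTail`).

## Mathlib

No Lorentzian geometry or null infinity in Mathlib; used are `TopologicalSpace.Opens`,
`Topology.IsOpenEmbedding`, `ContMDiffOn`, `fderiv`, conditionally complete `⨅` over `Fin n`
(`exists_eq_ciInf_of_finite`, `Real.iInf_nonneg`, `Real.iInf_of_isEmpty`), `Filter.Tendsto`.

## Not here

The located-leaf predicate `HasLocatedLeaf` of the same §1 (work item `defn-HasLocatedLeaf`,
which imports `farZone`/`centreDist` from this file) and the summit-side `Settles` /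
`HasPinnedLeaves` (they mention summit declarations, CONVENTIONS §2). No tame far frame is
constructed: that is analytic content (the stubs), not vocabulary.
-/

noncomputable section

open Set Filter Function Topology TopologicalSpace
open scoped Manifold ContDiff ENNReal

universe u

namespace Literature.Geometry.Lorentzian

/-! ### Far-frame geometry in the global chart `E4` (centre curves, tubes, dyadic shells) -/

section FarGeometry

variable {n : ℕ}

/-- Coordinate distance from `x` to the centre curve `c` at the coordinate time of `x`:
`wᶜ(x) = |x̲ − c(x⁰)|` (Euclidean distance in the slab `{x⁰ = const}` of the global chart).
[folklore] -/
def centreDist (c : ℝ → E3) (x : E4) : ℝ := ‖E4.spatial x - c (x 0)‖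

/-- Unfolding lemma for `centreDist`. [folklore] -/
theorem centreDist_def (c : ℝ → E3) (x : E4) : centreDist c x = ‖E4.spatial x - c (x 0)‖ := rfl

/-- The distance to a centre is nonnegative. [folklore] -/
theorem centreDist_nonneg (c : ℝ → E3) (x : E4) : 0 ≤ centreDist c x := norm_nonneg _

/-- At the point `(t, y)` the distance to the centre `c` is `|y − c(t)|`. [folklore] -/
@[simp]
theorem centreDist_ofTimeSpace (c : ℝ → E3) (t : ℝ) (y : E3) :
    centreDist c (E4.ofTimeSpace t y) = ‖y - c t‖ := by
  simp [centreDist]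

/-- Distance to the nearest of the `n` centres (`⨅` over `Fin n`; for `n = 0` the junk value `0`,
never used: frames have `0 < n`). [folklore] -/
def nearestDist (c : Fin n → ℝ → E3) (x : E4) : ℝ := ⨅ i, centreDist (c i) x

/-- Unfolding lemma for `nearestDist`. [folklore] -/
theorem nearestDist_def (c : Fin n → ℝ → E3) (x : E4) :
    nearestDist c x = ⨅ i, centreDist (c i) x := rfl

/-- The nearest-centre distance is at most the distance to any centre. [folklore] -/
theorem nearestDist_le_centreDist (c : Fin n → ℝ → E3) (x : E4) (i : Fin n) :
    nearestDist c x ≤ centreDist (c i) x :=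
  ciInf_le (Finite.bddBelow_range _) i

/-- The nearest-centre distance is nonnegative. [folklore] -/
theorem nearestDist_nonneg (c : Fin n → ℝ → E3) (x : E4) : 0 ≤ nearestDist c x :=
  Real.iInf_nonneg fun i ↦ centreDist_nonneg (c i) x

/-- If `i` is a nearest centre of `x`, the nearest-centre distance is the distance to `cᵢ`.
[folklore] -/
theorem nearestDist_eq_centreDist {c : Fin n → ℝ → E3} {x : E4} {i : Fin n}
    (h : ∀ j, centreDist (c i) x ≤ centreDist (c j) x) : nearestDist c x = centreDist (c i) x :=
  haveI : Nonempty (Fin n) := ⟨i⟩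
  le_antisymm (nearestDist_le_centreDist c x i) (le_ciInf h)

/-- With at least one centre, the nearest-centre distance is attained. [folklore] -/
theorem exists_nearestDist_eq_centreDist (c : Fin n → ℝ → E3) (x : E4) (hn : 0 < n) :
    ∃ i, nearestDist c x = centreDist (c i) x := by
  haveI : Nonempty (Fin n) := ⟨⟨0, hn⟩⟩
  obtain ⟨i, hi⟩ := exists_eq_ciInf_of_finite (f := fun i ↦ centreDist (c i) x)
  exact ⟨i, hi.symm⟩

/-- The FAR ZONE of a frame: coordinate times after `T₀`, outside all tubes of radius `Rt` around
the centre curves, `{x | x⁰ > T₀, |x̲ − cᵢ(x⁰)| > Rt ∀ i}` (the "wave zone" of the global chart;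
Christodoulou–Klainerman 1993, Ch. 17). [folklore] -/
def farZone (c : Fin n → ℝ → E3) (Rt T₀ : ℝ) : Set E4 :=
  {x | T₀ < x 0 ∧ ∀ i, Rt < centreDist (c i) x}

/-- Membership in the far zone. [folklore] -/
theorem mem_farZone_iff (c : Fin n → ℝ → E3) (Rt T₀ : ℝ) (x : E4) :
    x ∈ farZone c Rt T₀ ↔ T₀ < x 0 ∧ ∀ i, Rt < centreDist (c i) x :=
  Iff.rfl

/-- The far zone shrinks when the tube radius or the initial time grows. [folklore] -/
theorem farZone_subset_farZone (c : Fin n → ℝ → E3) {Rt Rt' T₀ T₀' : ℝ} (hR : Rt ≤ Rt')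
    (hT : T₀ ≤ T₀') : farZone c Rt' T₀' ⊆ farZone c Rt T₀ :=
  fun _ hx ↦ ⟨hT.trans_lt hx.1, fun i ↦ hR.trans_lt (hx.2 i)⟩

/-- The DYADIC SHELL on the slab `{x⁰ = T}`: points outside all tubes whose distance to the
nearest centre lies in `[s, 2s]`. [folklore] -/
def farShell (c : Fin n → ℝ → E3) (Rt T s : ℝ) : Set E4 :=
  {x | x 0 = T ∧ (∀ i, Rt < centreDist (c i) x) ∧ s ≤ nearestDist c x ∧ nearestDist c x ≤ 2 * s}

/-- Membership in the dyadic shell. [folklore] -/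
theorem mem_farShell_iff (c : Fin n → ℝ → E3) (Rt T s : ℝ) (x : E4) :
    x ∈ farShell c Rt T s ↔
      x 0 = T ∧ (∀ i, Rt < centreDist (c i) x) ∧ s ≤ nearestDist c x ∧ nearestDist c x ≤ 2 * s :=
  Iff.rfl

/-- A dyadic shell on a late slab `{x⁰ = T}`, `T > T₀`, lies in the far zone. [folklore] -/
theorem farShell_subset_farZone (c : Fin n → ℝ → E3) {Rt T₀ T : ℝ} (hT : T₀ < T) (s : ℝ) :
    farShell c Rt T s ⊆ farZone c Rt T₀ :=
  fun _ hx ↦ ⟨hT.trans_eq hx.1.symm, hx.2.1⟩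

/-- The dyadic shell of the VORONOI CELL of centre `i` on the slab `{x⁰ = T}`: points outside all
tubes, at distance `∈ [s, 2s]` from `cᵢ`, for which `i` is a nearest centre. [folklore] -/
def cellShell (c : Fin n → ℝ → E3) (i : Fin n) (Rt T s : ℝ) : Set E4 :=
  {x | x 0 = T ∧ (∀ j, Rt < centreDist (c j) x) ∧ s ≤ centreDist (c i) x ∧
    centreDist (c i) x ≤ 2 * s ∧ ∀ j, centreDist (c i) x ≤ centreDist (c j) x}

/-- Membership in the dyadic shell of a Voronoi cell. [folklore] -/
theorem mem_cellShell_iff (c : Fin n → ℝ → E3) (i : Fin n) (Rt T s : ℝ) (x : E4) :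
    x ∈ cellShell c i Rt T s ↔
      x 0 = T ∧ (∀ j, Rt < centreDist (c j) x) ∧ s ≤ centreDist (c i) x ∧
        centreDist (c i) x ≤ 2 * s ∧ ∀ j, centreDist (c i) x ≤ centreDist (c j) x :=
  Iff.rfl

/-- The dyadic shell of a Voronoi cell is part of the dyadic shell (on it the nearest-centre
distance is the distance to `cᵢ`). [folklore] -/
theorem cellShell_subset_farShell (c : Fin n → ℝ → E3) (i : Fin n) (Rt T s : ℝ) :
    cellShell c i Rt T s ⊆ farShell c Rt T s := by
  rintro x ⟨h0, hR, hs, h2s, hmin⟩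
  have h : nearestDist c x = centreDist (c i) x := nearestDist_eq_centreDist hmin
  exact ⟨h0, hR, h.symm ▸ hs, h.symm ▸ h2s⟩

/-- The dyadic shell is the union of the dyadic shells of the Voronoi cells (the nearest-centre
distance is attained, `0 < n`). [folklore] -/
theorem iUnion_cellShell (c : Fin n → ℝ → E3) (hn : 0 < n) (Rt T s : ℝ) :
    ⋃ i, cellShell c i Rt T s = farShell c Rt T s := by
  refine (iUnion_subset fun i ↦ cellShell_subset_farShell c i Rt T s).antisymm fun x hx ↦ ?_
  obtain ⟨i, hi⟩ := exists_nearestDist_eq_centreDist c x hn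
  obtain ⟨h0, hR, hs, h2s⟩ := hx
  rw [hi] at hs h2s
  exact mem_iUnion.2 ⟨i, h0, hR, hs, h2s, fun j ↦ hi.ge.trans (nearestDist_le_centreDist c x j)⟩

/-- The OUTGOING NULL VECTOR of centre `c` at `x` (Minkowski values, global chart):
`L = ∂₀ + (x̲ − c(x⁰))/|x̲ − c(x⁰)|`, i.e. `∂_t + ∂_w` with `w` the distance to the centre — the
generator of the outgoing cones of the far wave zone (Christodoulou–Klainerman 1993, Ch. 17:
`l = T + N` up to the lapse). [folklore] -/
def outgoingNull (c : ℝ → E3) (x : E4) : E4 :=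
  E4.ofTimeSpace 1 ((centreDist c x)⁻¹ • (E4.spatial x - c (x 0)))

/-- The time component of the outgoing null vector is `1`. [folklore] -/
@[simp]
theorem outgoingNull_apply_zero (c : ℝ → E3) (x : E4) : outgoingNull c x 0 = 1 := rfl

/-- The spatial part of the outgoing null vector is the unit radial vector from the centre.
[folklore] -/
@[simp]
theorem spatial_outgoingNull (c : ℝ → E3) (x : E4) :
    E4.spatial (outgoingNull c x) = (centreDist c x)⁻¹ • (E4.spatial x - c (x 0)) :=
  E4.spatial_ofTimeSpace _ _

/-- Off the centre curve the spatial part of the outgoing null vector is a unit vector (so that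
`L` is null for `η = −(dx⁰)² + |dx̲|²`). [folklore] -/
theorem norm_spatial_outgoingNull (c : ℝ → E3) {x : E4} (h : centreDist c x ≠ 0) :
    ‖E4.spatial (outgoingNull c x)‖ = 1 := by
  rw [spatial_outgoingNull, norm_smul, norm_inv, Real.norm_of_nonneg (centreDist_nonneg c x)]
  exact inv_mul_cancel₀ h

/-- SEPARATION of centre `i` from the other centres at time `t`: `min_{j ≠ i} |cᵢ(t) − cⱼ(t)|`
(`= 0` by convention when there is no other centre, `Real.iInf_of_isEmpty` — which kills the
companion term `C s / Dᵢ` of `IsTameFarFrameWithTail`, Lean's `x / 0 = 0`). [folklore] -/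
def separation (c : Fin n → ℝ → E3) (i : Fin n) (t : ℝ) : ℝ :=
  ⨅ j : {j : Fin n // j ≠ i}, ‖c i t - c j.1 t‖

/-- Unfolding lemma for `separation`. [folklore] -/
theorem separation_def (c : Fin n → ℝ → E3) (i : Fin n) (t : ℝ) :
    separation c i t = ⨅ j : {j : Fin n // j ≠ i}, ‖c i t - c j.1 t‖ := rfl

/-- The separation is nonnegative. [folklore] -/
theorem separation_nonneg (c : Fin n → ℝ → E3) (i : Fin n) (t : ℝ) : 0 ≤ separation c i t :=
  Real.iInf_nonneg fun _ ↦ norm_nonneg _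

/-- The separation of `i` is at most its distance to any other centre. [folklore] -/
theorem separation_le (c : Fin n → ℝ → E3) {i j : Fin n} (h : j ≠ i) (t : ℝ) :
    separation c i t ≤ ‖c i t - c j t‖ :=
  ciInf_le (Finite.bddBelow_range fun j : {j : Fin n // j ≠ i} ↦ ‖c i t - c j.1 t‖) ⟨j, h⟩

/-- The documented junk value: with a single centre (no `j ≠ i`) the separation is `0`.
[folklore] -/
theorem separation_eq_zero_of_subsingleton [Subsingleton (Fin n)] (c : Fin n → ℝ → E3)
    (i : Fin n) (t : ℝ) : separation c i t = 0 :=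
  haveI : IsEmpty {j : Fin n // j ≠ i} := ⟨fun j ↦ j.2 (Subsingleton.elim _ _)⟩
  Real.iInf_of_isEmpty _

/-- If every other centre recedes from `cᵢ` (as for the centres of a tame far frame), the
separation of `i` tends to `∞` — provided there is another centre. [folklore] -/
theorem tendsto_separation_atTop (c : Fin n → ℝ → E3) {i j₀ : Fin n} (hj₀ : j₀ ≠ i)
    (h : ∀ j, j ≠ i → Tendsto (fun t ↦ ‖c i t - c j t‖) atTop atTop) :
    Tendsto (separation c i) atTop atTop := by
  haveI : Nonempty {j : Fin n // j ≠ i} := ⟨⟨j₀, hj₀⟩⟩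
  rw [tendsto_atTop_atTop]
  intro b
  have H : ∀ j : {j : Fin n // j ≠ i}, ∃ a, ∀ t, a ≤ t → b ≤ ‖c i t - c j.1 t‖ := fun j ↦
    tendsto_atTop_atTop.1 (h j.1 j.2) b
  choose a ha using H
  obtain ⟨a₀, ha₀⟩ := Finite.bddAbove_range a
  exact ⟨a₀, fun t ht ↦ le_ciInf fun j ↦ ha j t ((ha₀ ⟨j, rfl⟩).trans ht)⟩

end FarGeometry

/-! ### Tame far frames (the objects `stub_farFrame` produces and `stub_farTail` improves) -/

section FarFrame

variable {X : Type u} [TopologicalSpace X] [ChartedSpace E3 X] [IsManifold (𝓡 3) ∞ X]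
  [ConnectedSpace X] {D : InitialDataSet (𝓡 3) X}

/-- The deviation `Φ^* g − η` of a far chart `Φ : U → 𝒟` from the Minkowski form, extended by `0`
off `U` (so that `iteratedFDeriv` / `supCkENorm` apply; on `U`, in particular on the far zone, it
is the honest deviation `Spacetime.deviation`). Consequence-form deviation vocabulary of DHRT
arXiv:2104.08222, §1 (`Spacetime.deviationExtend` against `Minkowski.backgroundOn U`).
[cite: DafermosHolzegelRodnianskiTaylor2021, §1] -/
def farDeviation (𝒟 : CauchyDevelopment D) (U : Opens E4) (Φ : U → 𝒟.carrier) :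
    E4 → E4 →L[ℝ] E4 →L[ℝ] ℝ :=
  𝒟.toSpacetime.deviationExtend (Minkowski.backgroundOn U) Φ

/-- Unfolding lemma for `farDeviation`. [cite: DafermosHolzegelRodnianskiTaylor2021, §1] -/
theorem farDeviation_def (𝒟 : CauchyDevelopment D) (U : Opens E4) (Φ : U → 𝒟.carrier) :
    farDeviation 𝒟 U Φ = 𝒟.toSpacetime.deviationExtend (Minkowski.backgroundOn U) Φ := rfl

/-- On `U` the far deviation is the honest deviation `Φ^* g − η`.
[cite: DafermosHolzegelRodnianskiTaylor2021, §1] -/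
@[simp]
theorem farDeviation_coe (𝒟 : CauchyDevelopment D) (U : Opens E4) (Φ : U → 𝒟.carrier) (x : U) :
    farDeviation 𝒟 U Φ x = 𝒟.toSpacetime.deviation (Minkowski.backgroundOn U) Φ x :=
  𝒟.toSpacetime.deviationExtend_coe (Minkowski.backgroundOn U) Φ x

/-- Off `U` the far deviation is the junk value `0`. [cite: DafermosHolzegelRodnianskiTaylor2021, §1] -/
theorem farDeviation_of_not_mem (𝒟 : CauchyDevelopment D) (U : Opens E4) (Φ : U → 𝒟.carrier)
    {y : E4} (hy : y ∉ U) : farDeviation 𝒟 U Φ y = 0 :=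
  𝒟.toSpacetime.deviationExtend_of_not_mem (Minkowski.backgroundOn U) Φ hy

/-- The INCOMING DERIVATIVE field of centre `c`: `x ↦ D(wᶜ · h)(x)[L(x)] = L(wᶜ · (Φ^*g − η))(x)`,
the outgoing null derivative of the radius-weighted deviation — the quantity whose smallness says
"no incoming radiation" (it annihilates `2M/r`, outgoing waves `h¹(u,ω)/r` and static multipoles
to leading order). Lowest-order peeling, pointwise along outgoing cones for all retarded times:
Christodoulou–Klainerman 1993, Ch. 17, Conclusion 17.0.1 (limits of `r α̲, r² β̲, r³ ρ, r³ σ` on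
every `C_u`); Klainerman–Nicolò, CQG 20 (2003).
[cite: ChristodoulouKlainerman1993PMS41, Ch. 17, Conclusion 17.0.1] -/
def incomingDeriv (𝒟 : CauchyDevelopment D) (c : ℝ → E3) (U : Opens E4) (Φ : U → 𝒟.carrier) :
    E4 → E4 →L[ℝ] E4 →L[ℝ] ℝ :=
  fun x ↦ fderiv ℝ (fun y ↦ centreDist c y • farDeviation 𝒟 U Φ y) x (outgoingNull c x)

/-- Unfolding lemma for `incomingDeriv`.
[cite: ChristodoulouKlainerman1993PMS41, Ch. 17, Conclusion 17.0.1] -/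
theorem incomingDeriv_apply (𝒟 : CauchyDevelopment D) (c : ℝ → E3) (U : Opens E4)
    (Φ : U → 𝒟.carrier) (x : E4) :
    incomingDeriv 𝒟 c U Φ x =
      fderiv ℝ (fun y ↦ centreDist c y • farDeviation 𝒟 U Φ y) x (outgoingNull c x) :=
  rfl

/-- **TAME FAR FRAME of order `k`** for the development `𝒟`: `n ≥ 1` continuous centre curves
`cᵢ : ℝ → E3`, a tube radius `Rt > 0`, constants `C, T₀`, a slack `λ → 0`, and ONE chart
`Φ : U → 𝒟` (`U ⊇` the far zone `{x⁰ > T₀, |x̲ − cᵢ(x⁰)| > Rt ∀ i}`), smooth and an open embedding on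
the far zone with image in `J⁺(ι X)`, such that on every late slab `{x⁰ = T}` the `Cᵏ` sup of
`Φ^* g − η` over the dyadic shell at nearest-centre distance `∼ s` is `≤ C/s + λ(T)`, and distinct
centres recede from each other. "Bounded charges + asymptotic flatness in one asymptotic frame, for
all late times" — a far-zone statement: nothing is small near the tubes. Route-posited notion of the
line `far-tail-peeling-one-leaf` of crux `Capture` (see the module docstring), verbatim §1 of its
skeleton; a hypothesis shape, not an assertion — no printed source for the predicate itself.
[folklore] -/
def IsTameFarFrame (𝒟 : CauchyDevelopment D) (k n : ℕ) (c : Fin n → ℝ → E3) (Rt C T₀ : ℝ)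
    (lam : ℝ → ℝ) (U : Opens E4) (Φ : U → 𝒟.carrier) : Prop :=
  0 < n ∧ 0 < Rt ∧ (∀ i, Continuous (c i)) ∧
  (∀ i j, i ≠ j → Tendsto (fun t ↦ ‖c i t - c j t‖) atTop atTop) ∧
  Tendsto lam atTop (𝓝 0) ∧
  farZone c Rt T₀ ⊆ (U : Set E4) ∧
  ContMDiffOn 𝓘(ℝ, E4) (𝓡 4) ∞ Φ {x | x.1 ∈ farZone c Rt T₀} ∧
  IsOpenEmbedding ({x : U | x.1 ∈ farZone c Rt T₀}.restrict Φ) ∧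
  Φ '' {x | x.1 ∈ farZone c Rt T₀} ⊆ 𝒟.metric.causalFuture 𝒟.timeOrientation (range 𝒟.embed) ∧
  ∀ T s : ℝ, T₀ < T → 0 < s →
    supCkENorm (farShell c Rt T s) k (farDeviation 𝒟 U Φ) ≤ ENNReal.ofReal (C / s + lam T)

/-- **TAME FAR FRAME WITH TAIL** (order `k`, modulus `ω → 0`): a tame far frame in which, moreover,
the incoming derivative of every centre `i`, in `Cᵏ` sup over the dyadic shell of `i`'s Voronoi
cell at distance `∼ s` on the slab `{x⁰ = T}`, is `≤ (ω(s) + λ(T))/s + C s / Dᵢ(T)` — the datum's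
`o₂` tail transported (rate-free in `s`), early junk (`λ`), and the companions' outgoing radiation
seen as incoming at relative size `s/Dᵢ` (`Dᵢ = separation c i T`; for a single centre the last
term is `0`). For `p < 1` it gives incoming `p`-flux through the outgoing cone from radius `R′` of
size `≲ (sup_{s ≥ R′} ω + λ)² R′^{p-1} + C² D^{p-1} → 0`. Route-posited (see `IsTameFarFrame`);
the peeling it encodes at lowest order: Christodoulou–Klainerman 1993, Ch. 17, Conclusion 17.0.1.
[cite: ChristodoulouKlainerman1993PMS41, Ch. 17, Conclusion 17.0.1] -/
def IsTameFarFrameWithTail (𝒟 : CauchyDevelopment D) (k n : ℕ) (c : Fin n → ℝ → E3)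
    (Rt C T₀ : ℝ) (lam om : ℝ → ℝ) (U : Opens E4) (Φ : U → 𝒟.carrier) : Prop :=
  IsTameFarFrame 𝒟 k n c Rt C T₀ lam U Φ ∧ Tendsto om atTop (𝓝 0) ∧
  ∀ (i : Fin n) (T s : ℝ), T₀ < T → 0 < s →
    supCkENorm (cellShell c i Rt T s) k (incomingDeriv 𝒟 (c i) U Φ) ≤
      ENNReal.ofReal ((om s + lam T) / s + C * s / separation c i T)

namespace IsTameFarFrame

variable {𝒟 : CauchyDevelopment D} {k k' n : ℕ} {c : Fin n → ℝ → E3} {Rt C T₀ : ℝ} {lam : ℝ → ℝ}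
  {U : Opens E4} {Φ : U → 𝒟.carrier}

/-- A tame far frame has at least one centre. [folklore] -/
theorem pos (h : IsTameFarFrame 𝒟 k n c Rt C T₀ lam U Φ) : 0 < n := h.1

/-- The tube radius of a tame far frame is positive. [folklore] -/
theorem radius_pos (h : IsTameFarFrame 𝒟 k n c Rt C T₀ lam U Φ) : 0 < Rt := h.2.1

/-- The centre curves of a tame far frame are continuous. [folklore] -/
theorem continuous_centre (h : IsTameFarFrame 𝒟 k n c Rt C T₀ lam U Φ) (i : Fin n) :
    Continuous (c i) :=
  h.2.2.1 i

/-- Distinct centres of a tame far frame recede from each other. [folklore] -/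
theorem tendsto_norm_sub (h : IsTameFarFrame 𝒟 k n c Rt C T₀ lam U Φ) {i j : Fin n} (hij : i ≠ j) :
    Tendsto (fun t ↦ ‖c i t - c j t‖) atTop atTop :=
  h.2.2.2.1 i j hij

/-- With `n ≥ 2` centres, the separation of every centre of a tame far frame tends to `∞` (so the
companion term `C s / Dᵢ(T)` of the tail bound decays). [folklore] -/
theorem tendsto_separation (h : IsTameFarFrame 𝒟 k n c Rt C T₀ lam U Φ) {i j₀ : Fin n}
    (hj₀ : j₀ ≠ i) : Tendsto (separation c i) atTop atTop :=
  tendsto_separation_atTop c hj₀ fun _ hj ↦ h.tendsto_norm_sub hj.symm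

/-- The slack of a tame far frame tends to `0`. [folklore] -/
theorem tendsto_slack (h : IsTameFarFrame 𝒟 k n c Rt C T₀ lam U Φ) : Tendsto lam atTop (𝓝 0) :=
  h.2.2.2.2.1

/-- The chart domain of a tame far frame contains the far zone. [folklore] -/
theorem farZone_subset (h : IsTameFarFrame 𝒟 k n c Rt C T₀ lam U Φ) :
    farZone c Rt T₀ ⊆ (U : Set E4) :=
  h.2.2.2.2.2.1

/-- The chart of a tame far frame is smooth on the far zone. [folklore] -/
theorem contMDiffOn (h : IsTameFarFrame 𝒟 k n c Rt C T₀ lam U Φ) :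
    ContMDiffOn 𝓘(ℝ, E4) (𝓡 4) ∞ Φ {x | x.1 ∈ farZone c Rt T₀} :=
  h.2.2.2.2.2.2.1

/-- The chart of a tame far frame is an open embedding of the far zone. [folklore] -/
theorem isOpenEmbedding (h : IsTameFarFrame 𝒟 k n c Rt C T₀ lam U Φ) :
    IsOpenEmbedding ({x : U | x.1 ∈ farZone c Rt T₀}.restrict Φ) :=
  h.2.2.2.2.2.2.2.1

/-- The chart of a tame far frame maps the far zone into `J⁺(ι X)`. [folklore] -/
theorem image_subset_causalFuture (h : IsTameFarFrame 𝒟 k n c Rt C T₀ lam U Φ) :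
    Φ '' {x | x.1 ∈ farZone c Rt T₀} ⊆ 𝒟.metric.causalFuture 𝒟.timeOrientation (range 𝒟.embed) :=
  h.2.2.2.2.2.2.2.2.1

/-- The dyadic-shell bound of a tame far frame: `‖Φ^* g − η‖_{Cᵏ(farShell)} ≤ C/s + λ(T)`.
[folklore] -/
theorem supCkENorm_farShell_le (h : IsTameFarFrame 𝒟 k n c Rt C T₀ lam U Φ) {T s : ℝ}
    (hT : T₀ < T) (hs : 0 < s) :
    supCkENorm (farShell c Rt T s) k (farDeviation 𝒟 U Φ) ≤ ENNReal.ofReal (C / s + lam T) :=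
  h.2.2.2.2.2.2.2.2.2 T s hT hs

/-- The same bound on the dyadic shell of each Voronoi cell (`cellShell ⊆ farShell`). [folklore] -/
theorem supCkENorm_cellShell_le (h : IsTameFarFrame 𝒟 k n c Rt C T₀ lam U Φ) (i : Fin n)
    {T s : ℝ} (hT : T₀ < T) (hs : 0 < s) :
    supCkENorm (cellShell c i Rt T s) k (farDeviation 𝒟 U Φ) ≤ ENNReal.ofReal (C / s + lam T) :=
  (supCkENorm_mono (cellShell_subset_farShell c i Rt T s) k _).trans (h.supCkENorm_farShell_le hT hs)

/-- Tame far frames lose nothing when the order is lowered (`supCkENorm` is monotone in `k`).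
[folklore] -/
theorem of_le (h : IsTameFarFrame 𝒟 k' n c Rt C T₀ lam U Φ) (hk : k ≤ k') :
    IsTameFarFrame 𝒟 k n c Rt C T₀ lam U Φ := by
  obtain ⟨h1, h2, h3, h4, h5, h6, h7, h8, h9, h10⟩ := h
  exact ⟨h1, h2, h3, h4, h5, h6, h7, h8, h9,
    fun T s hT hs ↦ (supCkENorm_mono_right _ hk _).trans (h10 T s hT hs)⟩

end IsTameFarFrame

namespace IsTameFarFrameWithTail

variable {𝒟 : CauchyDevelopment D} {k k' n : ℕ} {c : Fin n → ℝ → E3} {Rt C T₀ : ℝ}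
  {lam om : ℝ → ℝ} {U : Opens E4} {Φ : U → 𝒟.carrier}

/-- A tame far frame with tail is in particular a tame far frame. [folklore] -/
theorem isTameFarFrame (h : IsTameFarFrameWithTail 𝒟 k n c Rt C T₀ lam om U Φ) :
    IsTameFarFrame 𝒟 k n c Rt C T₀ lam U Φ :=
  h.1

/-- The tail modulus of a tame far frame with tail tends to `0`. [folklore] -/
theorem tendsto_modulus (h : IsTameFarFrameWithTail 𝒟 k n c Rt C T₀ lam om U Φ) :
    Tendsto om atTop (𝓝 0) :=
  h.2.1

/-- The INCOMING-TAIL bound of a tame far frame with tail: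
`‖L(wᵢ · h)‖_{Cᵏ(cellShell i)} ≤ (ω(s) + λ(T))/s + C s / Dᵢ(T)`.
[cite: ChristodoulouKlainerman1993PMS41, Ch. 17, Conclusion 17.0.1] -/
theorem supCkENorm_incomingDeriv_le (h : IsTameFarFrameWithTail 𝒟 k n c Rt C T₀ lam om U Φ)
    (i : Fin n) {T s : ℝ} (hT : T₀ < T) (hs : 0 < s) :
    supCkENorm (cellShell c i Rt T s) k (incomingDeriv 𝒟 (c i) U Φ) ≤
      ENNReal.ofReal ((om s + lam T) / s + C * s / separation c i T) :=
  h.2.2 i T s hT hs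

/-- Tame far frames with tail lose nothing when the order is lowered. [folklore] -/
theorem of_le (h : IsTameFarFrameWithTail 𝒟 k' n c Rt C T₀ lam om U Φ) (hk : k ≤ k') :
    IsTameFarFrameWithTail 𝒟 k n c Rt C T₀ lam om U Φ :=
  ⟨h.1.of_le hk, h.2.1, fun i T s hT hs ↦ (supCkENorm_mono_right _ hk _).trans (h.2.2 i T s hT hs)⟩

end IsTameFarFrameWithTail

end FarFrame

end Literature.Geometry.Lorentzian

end
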